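import Literature.AlgebraicGeometry.HodgeTheory.UnitaryReflectionGroupZariskiDenseHolds
import HarnessLib

/-!
# Crux K1 `VeryGeneralDeckCommutatorsInHg` (route `CyclicUnitaryPowers`, stmt-HodgeConjecture-19544): the fact
# binder `stub_ct99Density` LANDED as a theorem

The registered skeleton v9 of the crux (`Cruxes/VeryGeneralDeckCommutatorsInHg/Lines/unitary-reflection-zariski`,
planner P3 g23) binds Carlson–Toledo's density theorem for unitary reflection groups
(`Literature.AlgebraicGeometry.HodgeTheory.carlsonToledo1999_unitaryReflection_zariskiDense`, Duke Math. J. 97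
(1999) §7 Theorem `udensitytheo`) as the stub `stub_ct99Density`. That fact is now a THEOREM of the tree
(`Literature/AlgebraicGeometry/HodgeTheory/UnitaryReflectionGroupZariskiDenseHolds.lean`,
`carlsonToledo1999_unitaryReflection_zariskiDense_holds`: an algebraic proof through the Lie algebra of the
Zariski closure — files `UnitaryReflectionLie{Projector,Irreducible,Core,Closure}`, `UnitaryReflectionRealTransfer`,
prover-Bx g6). This file records the stub BY NAME and signature, so the binder expires from the crux's registry;
the crux itself modulo the remaining THREE cited facts is `CyclicUnitaryPowersThreeFacts`. Written by the prover
seat `hodge-nonav-prover-Bx` (g6). Nothing here says HC ∕ HC_AV is proved; rung F-H1 not moved.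

## References
* [CarlsonToledo1999] J. A. Carlson, D. Toledo, *Discriminant complements and kernels of monodromy
  representations*, Duke Math. J. 97 (1999), §7 Theorem `udensitytheo`.
-/

noncomputable section

-- mandated namespace `Summit.HodgeConjecture.HodgeConjecture.Theorems` trips `linter.dupNamespace` (off tree-wide)
set_option linter.dupNamespace false

namespace Summit.HodgeConjecture.HodgeConjecture.Theorems.CyclicUnitaryPowersCT99Density

/-- **Stub `stub_ct99Density` of line `unitary-reflection-zariski` (v9) of crux K1 `VeryGeneralDeckCommutatorsInHg`,
PROVED**: Carlson–Toledo's density theorem `carlsonToledo1999_unitaryReflection_zariskiDense` holds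
(`carlsonToledo1999_unitaryReflection_zariskiDense_holds`). [cite: CarlsonToledo1999, §7 Theorem udensitytheo] -/
theorem stub_ct99Density : Literature.AlgebraicGeometry.HodgeTheory.carlsonToledo1999_unitaryReflection_zariskiDense :=
  Literature.AlgebraicGeometry.HodgeTheory.carlsonToledo1999_unitaryReflection_zariskiDense_holds

end Summit.HodgeConjecture.HodgeConjecture.Theorems.CyclicUnitaryPowersCT99Density

end
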